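import Literature.NumberTheory.LFunctions.Zhang2022.RepairBedDefectLadder
import Literature.NumberTheory.LFunctions.Zhang2022.RepairBedLadderCertificates
import Literature.NumberTheory.QuadraticFields.QuadraticDedekindZetaKronecker
import Literature.NumberTheory.QuadraticFields.ImaginaryQuadraticClassNumberValues
import Literature.NumberTheory.QuadraticFields.ImaginaryResiduePiForm
import Literature.NumberTheory.QuadraticFields.FundamentalDiscriminant
import Literature.NumberTheory.QuadraticFields.RealQuadraticRegulator
import Literature.NumberTheory.QuadraticFields.RingClassUnits
import HarnessLib

/-!
# Zhang (2022) rescue bed (D-0124 (3)): the CLASS NUMBER `h(D)` and DIRICHLET'S CLASS NUMBER FORMULA at the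
# bed's characters `χ_D` — bed-1 block G101, columns G01 (`h(D)`, regulator) and G02(i) (`L(1,χ_D)` from `h(D)`)

Topic `Literature/NumberTheory/LFunctions/Zhang2022` (Landau–Siegel audit tree; verdict-neutral), cell landau-siegel,
LS RESCUE PROTOCOL (human ruling D-0124) part (3) «GENUINE BED», typer seat ls-rescue-typ-1 (charter: «type the BED
OBJECTS … so bed values have a typed referent»). Y. Zhang, *Discrete mean estimates and the Landau–Siegel zero*,
arXiv:2211.02515v1 (2022) [Zhang2022LandauSiegel] — an unrefereed manuscript under adjudication. **Nothing in this file
asserts or denies any of its claims; nothing here is a claim about Landau–Siegel zeros. The programme SEARCHES and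
TYPES; no claim about Landau–Siegel zeros, Theorems 1–2 of arXiv:2211.02515 or a repaired Margin232 until a kernel
theorem says so.** Everything below is PROVED (theorems only; no definition, no named fact, no instance).

## Why this file

The bed-1 pre-registration `rescue/ls-rescue-bed-1/bed1-KG1-v0.1.json` (sha16 `dea02fd073922aeb`), block
`G101_A_defect_ladder`, has the columns G01 = "`h(D)` (class number; `D > 0` also the regulator `log ε_D`)" and
G02 = "`L(1, χ_D)` two ways per engine: (i) class-number formula from G01, (ii) analytic". The rescue table BED.md
§1 carried «G01 `h(D)`: no referent typed (class number as a term would need the field construction; engines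
cross-check by the class-number formula)». Both the term AND the cross-check are in the tree:

* the term: `Literature.NumberTheory.QuadraticFields.Quadratic.BinQF.classNumber D` — the number of reduced
  primitive positive definite forms of discriminant `D < 0` (computable; `decide` evaluates it), with the PROVED
  identification `ClassNumberValues.classNumber_eq_of_discr_eq` (`h_K = h(d_K)`, Cox Thm. 2.13 / 7.7(ii)) and kernel
  values (`BinQF.classNumber_eq_one_of_mem_classNumberOneDiscrs` = the nine of bed list `L1a`;
  `BinQF.classNumber_examples` = `h(−15) = h(−20) = h(−24) = 2`, `h(−23) = 3`); for `D > 0` the class number is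
  `NumberField.classNumber K` of the quadratic field `K` with `d_K = D` (`Quadratic.exists_numberField_discr_eq`) and the
  regulator is `NumberField.Units.regulator K = log (QuadIrr.fundUnit D)` (`Quadratic.regulator_eq_log_fundUnit'`);
* the cross-check: **Dirichlet's class number formula is a kernel theorem** for every Dirichlet character `κ ≠ 1` with
  `ζ_K = ζ·L(κ)` (`Quadratic.LFunction_one_eq_dedekindZeta_residue_of_eq`, `…_of_discr_neg_of_eq`, from Mathlib's
  `NumberField.tendsto_sub_one_mul_dedekindZeta_nhdsGT`), and `ζ_K = ζ·L(κ)` holds for every `κ` with the KRONECKER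
  VALUES of `d_K` (`Quadratic.dedekindZeta_eq_riemannZeta_mul_LSeries_of_kronecker`) — which is exactly what
  `KroneckerCharacter.isKroneckerChar_kroneckerChar` certifies for the bed's term `kroneckerChar D`.

This file wires the bed vocabulary (`kroneckerChar D`, `Repair.Bed.LOne D` = `L(1, χ_D)` as a real number) to that
library. Consequence for the bed: at every NEGATIVE fundamental modulus the G02(i) value is a KERNEL IDENTITY in the
computable G01 value — `LOne D = π·h(D)/√|D|` for `D < −4` — so an engine disagreement (i) ≠ (ii) there is an engine
defect by a kernel theorem; at positive moduli `LOne D = 2 h_K log ε_D/√D`.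

## What is here (all PROVED)

* `isFundamentalDiscriminant_of_discr_eq` — `d_K` of a quadratic field is a fundamental discriminant (tree predicate
  `IsFundamentalDiscriminant`; `Quadratic.isFundamentalDiscriminant_discr`).
* **`dedekindZeta_eq_riemannZeta_mul_LSeries_kroneckerChar`** — `ζ_K(s) = ζ(s)·L(s, χ_D)` (`Re s > 1`) for EVERY
  quadratic field `K` with `d_K = D`, both parities of `D`.
* **`LFunction_kroneckerChar_one_eq_residue`**, **`LOne_eq_dedekindZeta_residue`** — `L(1, χ_D) = Res_{s=1} ζ_K(s)`
  (Mathlib's `NumberField.dedekindZeta_residue K = 2^{r₁}(2π)^{r₂} R_K h_K/(w_K √|d_K|)`).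
* `D < 0`: **`LOne_eq_of_discr_neg`** (`= 2π h_K/(w_K√|D|)`), **`LOne_eq_binQFClassNumber_of_discr_neg`**
  (`h_K ↦ BinQF.classNumber D`), and the FIELD-FREE **`LOne_eq_pi_mul_classNumber_div_sqrt`**: for every fundamental
  `D < −4`, `LOne D = π · BinQF.classNumber D / √|D|`.
* `D > 0`: **`LOne_eq_of_discr_pos`** (`= 2 h_K R_K/√D`), **`LOne_eq_log_fundUnit_of_discr_pos`**
  (`= 2 h_K log ε_D/√D`, `ε_D = QuadIrr.fundUnit D`), `exists_field_LOne_eq_of_pos` (field-free packaging).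
* Kernel values owed by the bed lists: `binQFClassNumber_neg1155 : h(−1155) = 8`, the deep all-inert ladder rung
  `binQFClassNumber_neg77683 : h(D₄₁⁻) = h(−77683) = 22` (+ `LOne_neg77683 = 22π/√77683`), and the closed forms of the G02
  column at the negative moduli of `L1a ∪ L1b` with `|D| > 4`: `LOne_eq_pi_div_sqrt_of_mem` (the seven class-number-one
  moduli `−7, −8, −11, −19, −43, −67, −163`: `LOne D = π/√|D|`), `LOne_neg15`, `LOne_neg20`, `LOne_neg23`, `LOne_neg24`,
  `LOne_neg1155` (`= 8π/√1155`). (`D = −3, −4` are covered by `LOne_eq_of_discr_neg` with `w_K`; their closed forms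
  `π/(3√3)`, `π/4` need `w_K = 6, 4`, not in the tree as lemmas about `d_K = −3, −4`.)
* Rev 2 (append): `torsionOrder_eq_card_units_of_discr_neg` (`w_K = #𝓞_Kˣ` for `d_K < 0`),
  `torsionOrder_eq_four_of_discr_eq_neg_four`, `torsionOrder_eq_six_of_discr_eq_neg_three` (via the tree's
  `RingClass.card_units_eq`), hence **`LOne_neg4 : L(1, χ_{−4}) = π/4`** and **`LOne_neg3 : L(1, χ_{−3}) = π/(3√3)`** —
  the G02 column is now a kernel constant at all fourteen negative moduli of `L1a ∪ L1b`.
* Rev 3 (append): the NEGATIVE L2 CHAMPIONS of record (bed1-KG1 rule L2, 200 < |D| ≤ 3·10⁵: min `L(1, χ_D)` at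
  `D = −222643`, min `L(1, χ_D)·log log|D|` at `D = −427`): `isFundamentalDiscriminant_neg427 / _neg222643` (finite check),
  **`binQFClassNumber_neg427 = 2`**, **`binQFClassNumber_neg222643 = 33`** (kernel `decide`, ≈ 1.4·10⁵ candidate forms),
  **`LOne_neg427 = 2π/√427`**, **`LOne_neg222643 = 33π/√222643`** (`= 0.21971…`, the smallest genuine `L(1, χ)` on the bed).

## References

* [NeukirchANT1999] J. Neukirch, *Algebraic Number Theory* (1999), Ch. VII §5 (5.11)–(5.12) (class number formula,
  `ζ_K = ζ·L`).
* [DavenportMNT1980] H. Davenport, *Multiplicative Number Theory*, 2nd ed. (1980), Ch. 6 (Dirichlet's class number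
  formula: `h(d) = w|d|^{1/2} L(1,χ_d)/(2π)` for `d < 0`, `h(d) = d^{1/2} L(1,χ_d)/log ε` for `d > 0` … with
  `2 log ε` in our normalisation `t² − du² = ±4`).
* [Cox2013] D. A. Cox, *Primes of the form x² + ny²*, 2nd ed. (2013), Thm. 2.13, Thm. 7.7(ii).
* [JacobsonWilliams2008] M. J. Jacobson, H. C. Williams, *Solving the Pell Equation* (2008), §5.3.
* [MontgomeryVaughan2007] H. L. Montgomery, R. C. Vaughan, *Multiplicative Number Theory I* (2007), §9.3, §10.1 Ex. 26.
-/

noncomputable section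

open NumberField NumberField.Units

namespace Literature.NumberTheory.LFunctions.Zhang2022.Repair.Bed

open Literature.NumberTheory.LFunctions.KroneckerCharacter
open Literature.NumberTheory.LFunctions.ChamizoJimenezUrroz2021 (IsKroneckerChar)
open Literature.Barriers.RiemannHypothesis (IsFundamentalDiscriminant)
open Literature.NumberTheory.QuadraticFields
open Literature.NumberTheory.QuadraticFields.Quadratic

/-! ## §1 `ζ_K = ζ · L(χ_D)` for every quadratic field of discriminant `D` -/

section Field

variable {K : Type*} [Field K] [NumberField K]

/-- The discriminant of a quadratic field is a fundamental discriminant, in the tree's predicate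
`IsFundamentalDiscriminant` (whose body is literally the statement of `Quadratic.isFundamentalDiscriminant_discr`).
[cite: Cox2013, §5.B and Ex. 5.13] -/
theorem isFundamentalDiscriminant_of_discr_eq (h2 : Module.finrank ℚ K = 2) {D : ℤ}
    (hd : NumberField.discr K = D) : IsFundamentalDiscriminant D := by
  rw [← hd]
  exact isFundamentalDiscriminant_discr h2

/-- **`ζ_K(s) = ζ(s) · L(s, χ_D)` on `Re s > 1`** for every quadratic field `K` with `d_K = D` (any sign, any parity
of `D`), where `χ_D = kroneckerChar D` is the bed's term: its values at the primes are the Kronecker values of `d_K`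
(`isKroneckerChar_kroneckerChar`), which is the hypothesis of `Quadratic.dedekindZeta_eq_riemannZeta_mul_LSeries_of_kronecker`
(decomposition law + Euler products). [cite: NeukirchANT1999, Ch. VII §5 (5.12)] [cite: MontgomeryVaughan2007, §10.1 Exercise 26] -/
theorem dedekindZeta_eq_riemannZeta_mul_LSeries_kroneckerChar (h2 : Module.finrank ℚ K = 2) {D : ℤ}
    (hd : NumberField.discr K = D) [NeZero D.natAbs] {s : ℂ} (hs : 1 < s.re) :
    NumberField.dedekindZeta K s = riemannZeta s * LSeries (fun n => kroneckerChar D n) s := by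
  obtain ⟨-, hodd, htwo⟩ := isKroneckerChar_kroneckerChar (isFundamentalDiscriminant_of_discr_eq h2 hd)
  subst hd
  exact dedekindZeta_eq_riemannZeta_mul_LSeries_of_kronecker h2 (kroneckerChar (NumberField.discr K))
    hodd htwo hs

/-- The same on the real axis `s > 1` (the shape consumed by the class number formula lemmas).
[cite: NeukirchANT1999, Ch. VII §5 (5.12)] -/
theorem dedekindZeta_eq_riemannZeta_mul_LSeries_kroneckerChar_real (h2 : Module.finrank ℚ K = 2) {D : ℤ}
    (hd : NumberField.discr K = D) [NeZero D.natAbs] (s : ℝ) (hs : 1 < s) :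
    NumberField.dedekindZeta K s = riemannZeta s * LSeries (fun n => kroneckerChar D n) s :=
  dedekindZeta_eq_riemannZeta_mul_LSeries_kroneckerChar h2 hd (by simpa using hs)

/-! ## §2 `L(1, χ_D)` is the residue of `ζ_K` at `s = 1` (Dirichlet's class number formula, general shape) -/

/-- **`L(1, χ_D) = Res_{s=1} ζ_K(s) = 2^{r₁}(2π)^{r₂} R_K h_K/(w_K √|d_K|)`** for every quadratic field `K` with
`d_K = D` (`χ_D ≠ 1` by `kroneckerChar_ne_one`; `Quadratic.LFunction_one_eq_dedekindZeta_residue_of_eq`).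
[cite: NeukirchANT1999, Ch. VII §5 (5.11)] -/
theorem LFunction_kroneckerChar_one_eq_residue (h2 : Module.finrank ℚ K = 2) {D : ℤ}
    (hd : NumberField.discr K = D) [NeZero D.natAbs] :
    (kroneckerChar D).LFunction 1 = (NumberField.dedekindZeta_residue K : ℂ) :=
  LFunction_one_eq_dedekindZeta_residue_of_eq
    (kroneckerChar_ne_one (isFundamentalDiscriminant_of_discr_eq h2 hd))
    (fun s hs => dedekindZeta_eq_riemannZeta_mul_LSeries_kroneckerChar_real h2 hd s hs)

/-- **Bed form: `LOne D = Res_{s=1} ζ_K(s)`** (`Repair.Bed.LOne D` = `Re L(1, χ_D)`, the G02 quantity) for every quadratic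
field `K` with `d_K = D`. [cite: NeukirchANT1999, Ch. VII §5 (5.11)] -/
theorem LOne_eq_dedekindZeta_residue (h2 : Module.finrank ℚ K = 2) {D : ℤ} (hd : NumberField.discr K = D) :
    LOne D = NumberField.dedekindZeta_residue K := by
  have h0 : D ≠ 0 := by rw [← hd]; exact NumberField.discr_ne_zero K
  haveI : NeZero D.natAbs := ⟨Int.natAbs_ne_zero.mpr h0⟩
  have hL : LOne D = ((kroneckerChar D).LFunction 1).re := by simp only [LOne, dif_neg h0]
  rw [hL, LFunction_kroneckerChar_one_eq_residue h2 hd, Complex.ofReal_re]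

/-! ## §3 Negative discriminants: `LOne D = 2π h_K/(w_K √|D|) = π · h(D)/√|D|` -/

/-- **Imaginary case with the field: `LOne D = 2π h_K/(w_K √|D|)`** for every quadratic `K` with `d_K = D < 0`
(`r₁ = 0`, `r₂ = 1`, `R_K = 1`: `Quadratic.dedekindZeta_residue_eq_of_discr_neg`). Covers `D = −3, −4` (`w_K = 6, 4`).
[cite: NeukirchANT1999, Ch. VII §5 (5.11)] [cite: DavenportMNT1980, Ch. 6] -/
theorem LOne_eq_of_discr_neg (h2 : Module.finrank ℚ K = 2) {D : ℤ} (hd : NumberField.discr K = D) (hD : D < 0) :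
    LOne D = 2 * Real.pi * NumberField.classNumber K / (torsionOrder K * Real.sqrt |(D : ℝ)|) := by
  rw [LOne_eq_dedekindZeta_residue h2 hd, dedekindZeta_residue_eq_of_discr_neg h2 (by rw [hd]; exact hD), hd]

/-- **`h_K ↦ h(D)`: `LOne D = 2π · BinQF.classNumber D/(w_K √|D|)`** for every quadratic `K` with `d_K = D < 0` — the
class number of the field IS the computable reduced-forms count (`ClassNumberValues.classNumber_eq_of_discr_eq`).
[cite: Cox2013, Thm. 2.13 and Thm. 7.7(ii)] [cite: NeukirchANT1999, Ch. VII §5 (5.11)] -/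
theorem LOne_eq_binQFClassNumber_of_discr_neg (h2 : Module.finrank ℚ K = 2) {D : ℤ}
    (hd : NumberField.discr K = D) (hD : D < 0) :
    LOne D = 2 * Real.pi * BinQF.classNumber D / (torsionOrder K * Real.sqrt |(D : ℝ)|) := by
  rw [LOne_eq_of_discr_neg h2 hd hD, ClassNumberValues.classNumber_eq_of_discr_eq h2 hd hD rfl]

end Field

/-- **Dirichlet's class number formula at the bed's characters, field-free: for every fundamental discriminant
`D < −4`, `L(1, χ_D) = π · h(D)/√|D|`**, with `h(D) = BinQF.classNumber D` the (computable) number of reduced primitive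
positive definite forms of discriminant `D` (G01) and `L(1, χ_D) = LOne D` (G02). The quadratic field of discriminant `D`
exists (`Quadratic.exists_numberField_discr_eq`) and has `w_K = 2` (`torsionOrder_eq_two_of_discr_lt_neg_four`). This is
the G02(i) ≡ G02(ii) cross-check of bed-1 block G101 as a KERNEL IDENTITY at every negative modulus with `|D| > 4`.
[cite: DavenportMNT1980, Ch. 6] [cite: NeukirchANT1999, Ch. VII §5 (5.11)] -/
theorem LOne_eq_pi_mul_classNumber_div_sqrt {D : ℤ} (hD : IsFundamentalDiscriminant D) (h4 : D < -4) :
    LOne D = Real.pi * BinQF.classNumber D / Real.sqrt |(D : ℝ)| := by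
  obtain ⟨K, _, _, h2, hdK⟩ := exists_numberField_discr_eq hD
  rw [LOne_eq_binQFClassNumber_of_discr_neg h2 hdK (by omega),
    torsionOrder_eq_two_of_discr_lt_neg_four h2 (by rw [hdK]; exact h4)]
  push_cast
  ring

/-! ## §4 Positive discriminants: `LOne D = 2 h_K R_K/√D = 2 h_K log ε_D/√D` -/

section Real

variable {K : Type*} [Field K] [NumberField K]

/-- **Real case: `LOne D = 2 h_K R_K/√D`** for every quadratic `K` with `d_K = D > 0` (`r₁ = 2`, `r₂ = 0`, `w_K = 2`:
`Quadratic.nrRealPlaces_eq_two_and_nrComplexPlaces_eq_zero`, `Quadratic.torsionOrder_eq_two_of_discr_pos`). Here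
`h_K = NumberField.classNumber K` and `R_K = NumberField.Units.regulator K` are the G01 referents at `D > 0`.
[cite: NeukirchANT1999, Ch. VII §5 (5.11)] [cite: DavenportMNT1980, Ch. 6] -/
theorem LOne_eq_of_discr_pos (h2 : Module.finrank ℚ K = 2) {D : ℤ} (hd : NumberField.discr K = D) (hD : 0 < D) :
    LOne D = 2 * NumberField.classNumber K * regulator K / Real.sqrt (D : ℝ) := by
  have hd' : 0 < NumberField.discr K := by rw [hd]; exact hD
  obtain ⟨hr, hc⟩ := nrRealPlaces_eq_two_and_nrComplexPlaces_eq_zero h2 hd'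
  rw [LOne_eq_dedekindZeta_residue h2 hd, NumberField.dedekindZeta_residue_def, hr, hc,
    torsionOrder_eq_two_of_discr_pos h2 hd', hd]
  have habs : |(D : ℝ)| = D := abs_of_pos (by exact_mod_cast hD)
  rw [habs]
  push_cast
  ring

/-- **`R_K ↦ log ε_D`: `LOne D = 2 h_K · log (QuadIrr.fundUnit D)/√D`** for every quadratic `K` with `d_K = D > 0`,
where `QuadIrr.fundUnit D = ε_D` is the tree's fundamental unit `(t + u√D)/2` of the principal cycle
(`Quadratic.regulator_eq_log_fundUnit'`; kernel values `QuadIrr.fundUnit_five = (1+√5)/2`, `fundUnit_eight = 1+√2`) —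
the G01 «regulator `log ε_D`» column. [cite: JacobsonWilliams2008, §5.3 (p. 112 and (5.33)–(5.34))] [cite: DavenportMNT1980, Ch. 6] -/
theorem LOne_eq_log_fundUnit_of_discr_pos (h2 : Module.finrank ℚ K = 2) {D : ℤ} (hd : NumberField.discr K = D)
    (hD : 0 < D) :
    LOne D = 2 * NumberField.classNumber K * Real.log (QuadIrr.fundUnit D.toNat) / Real.sqrt (D : ℝ) := by
  have hd' : 0 < NumberField.discr K := by rw [hd]; exact hD
  rw [LOne_eq_of_discr_pos h2 hd hD, regulator_eq_log_fundUnit' h2 hd', hd]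

end Real

/-- **Field-free packaging at `D > 0`**: for every fundamental discriminant `D > 0` there is a quadratic number field `K`
with `d_K = D` (`Quadratic.exists_numberField_discr_eq`; unique up to isomorphism), and for it
`LOne D = 2 h_K log ε_D/√D` — the G01 class number at a positive bed modulus is `NumberField.classNumber` of that field.
[cite: DavenportMNT1980, Ch. 6] [cite: Cox2013, §5.B and Ex. 5.13] -/
theorem exists_field_LOne_eq_of_pos {D : ℤ} (hD : IsFundamentalDiscriminant D) (h0 : 0 < D) :
    ∃ (K : Type) (_ : Field K) (_ : NumberField K), Module.finrank ℚ K = 2 ∧ NumberField.discr K = D ∧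
      LOne D = 2 * NumberField.classNumber K * Real.log (QuadIrr.fundUnit D.toNat) / Real.sqrt (D : ℝ) := by
  obtain ⟨K, hF, hN, h2, hdK⟩ := exists_numberField_discr_eq hD
  exact ⟨K, hF, hN, h2, hdK, LOne_eq_log_fundUnit_of_discr_pos h2 hdK h0⟩

/-! ## §5 Kernel values owed by the bed-1 lists (`L1a`, `L1b`): `h(−1155)` and the G02 column at the negative moduli -/

/-- **`h(−1155) = 8`** (the composite bed modulus `−1155 = −3·5·7·11` of list `L1b`; reduced forms `(1,1,289)`, `(3,3,97)`,
`(5,5,59)`, `(7,7,43)`, `(11,11,29)`, `(15,15,23)`, `(17,1,17)`, `(19,17,19)` — one class per genus, `2^{4−1} = 8` genera).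
Kernel-decided. [cite: Cox2013, Thm. 2.13 and §2.A (2.14)] -/
theorem binQFClassNumber_neg1155 : BinQF.classNumber (-1155) = 8 := by
  decide +kernel

/-- From a kernel class-number value to the closed form of `L(1, χ_D)`: `h(D) = h ⇒ LOne D = π h/√|D|` (`D < −4`
fundamental). [cite: DavenportMNT1980, Ch. 6] -/
theorem LOne_eq_of_classNumber_eq {D : ℤ} (hD : IsFundamentalDiscriminant D) (h4 : D < -4) {h : ℕ}
    (hh : BinQF.classNumber D = h) : LOne D = Real.pi * h / Real.sqrt |(D : ℝ)| := by
  rw [LOne_eq_pi_mul_classNumber_div_sqrt hD h4, hh]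

/-- **G02 at the class-number-one bed moduli with `|D| > 4`: `L(1, χ_D) = π/√|D|`** for
`D ∈ {−7, −8, −11, −19, −43, −67, −163}` (list `L1a` minus `−3, −4`; `h(D) = 1` by
`BinQF.classNumber_eq_one_of_mem_classNumberOneDiscrs`). E.g. `L(1, χ_{−163}) = π/√163 = 0.24606…`.
[cite: DavenportMNT1980, Ch. 6] [cite: Cox2013, Thm. 7.30(ii)] -/
theorem LOne_eq_pi_div_sqrt_of_mem {D : ℤ} (hD : D ∈ ([-7, -8, -11, -19, -43, -67, -163] : List ℤ)) :
    LOne D = Real.pi / Real.sqrt |(D : ℝ)| := by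
  have hfd : IsFundamentalDiscriminant D := by
    refine isFundamentalDiscriminant_of_mem_bed1Moduli D ?_
    simp only [bed1ModuliL1a, bed1ModuliL1b, List.mem_cons, List.mem_append] at hD ⊢
    rcases hD with h | h | h | h | h | h | h | h <;> simp [h]
  have h4 : D < -4 := by
    simp only [List.mem_cons, List.not_mem_nil, or_false] at hD
    rcases hD with rfl | rfl | rfl | rfl | rfl | rfl | rfl <;> norm_num
  have h1 : BinQF.classNumber D = 1 := by
    refine BinQF.classNumber_eq_one_of_mem_classNumberOneDiscrs ?_
    simp only [List.mem_cons, List.not_mem_nil, or_false] at hD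
    simp only [BinQF.classNumberOneDiscrs, Finset.mem_insert, Finset.mem_singleton]
    rcases hD with rfl | rfl | rfl | rfl | rfl | rfl | rfl <;> simp
  rw [LOne_eq_of_classNumber_eq hfd h4 h1, Nat.cast_one, mul_one]

/-- **`L(1, χ_{−15}) = 2π/√15`** (`h(−15) = 2`, `BinQF.classNumber_examples`). [cite: DavenportMNT1980, Ch. 6] -/
theorem LOne_neg15 : LOne (-15) = 2 * Real.pi / Real.sqrt 15 := by
  rw [LOne_eq_of_classNumber_eq (isFundamentalDiscriminant_of_mem_bed1Moduli (-15) (by decide)) (by norm_num)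
    BinQF.classNumber_examples.1]
  push_cast
  rw [abs_neg, Nat.abs_ofNat]
  ring

/-- **`L(1, χ_{−20}) = 2π/√20`** (`= π/√5`; `h(−20) = 2`). [cite: DavenportMNT1980, Ch. 6] -/
theorem LOne_neg20 : LOne (-20) = 2 * Real.pi / Real.sqrt 20 := by
  rw [LOne_eq_of_classNumber_eq (isFundamentalDiscriminant_of_mem_bed1Moduli (-20) (by decide)) (by norm_num)
    BinQF.classNumber_examples.2.1]
  push_cast
  rw [abs_neg, Nat.abs_ofNat]
  ring

/-- **`L(1, χ_{−23}) = 3π/√23`** (`h(−23) = 3`, the bed's generic `h = 3` field). [cite: DavenportMNT1980, Ch. 6] -/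
theorem LOne_neg23 : LOne (-23) = 3 * Real.pi / Real.sqrt 23 := by
  rw [LOne_eq_of_classNumber_eq (isFundamentalDiscriminant_of_mem_bed1Moduli (-23) (by decide)) (by norm_num)
    BinQF.classNumber_examples.2.2.2.1]
  push_cast
  rw [abs_neg, Nat.abs_ofNat]
  ring

/-- **`L(1, χ_{−24}) = 2π/√24`** (`h(−24) = 2`). [cite: DavenportMNT1980, Ch. 6] -/
theorem LOne_neg24 : LOne (-24) = 2 * Real.pi / Real.sqrt 24 := by
  rw [LOne_eq_of_classNumber_eq (isFundamentalDiscriminant_of_mem_bed1Moduli (-24) (by decide)) (by norm_num)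
    BinQF.classNumber_examples.2.2.1]
  push_cast
  rw [abs_neg, Nat.abs_ofNat]
  ring

/-- **`L(1, χ_{−1155}) = 8π/√1155`** (`= 0.7395…`; `h(−1155) = 8`, `binQFClassNumber_neg1155`).
[cite: DavenportMNT1980, Ch. 6] -/
theorem LOne_neg1155 : LOne (-1155) = 8 * Real.pi / Real.sqrt 1155 := by
  rw [LOne_eq_of_classNumber_eq (isFundamentalDiscriminant_of_mem_bed1Moduli (-1155) (by decide)) (by norm_num)
    binQFClassNumber_neg1155]
  push_cast
  rw [abs_neg, Nat.abs_ofNat]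
  ring

/-- **`h(D₄₁⁻) = h(D₄₃⁻) = h(−77683) = 22`** — the deep rung of the all-inert ladder (rule `L1y`, kernel certificate
`isLeastAllInert_neg77683`; `77683 = 131·593`). Kernel-decided (`≈ 5·10⁴` candidate forms). [cite: Cox2013, Thm. 2.13 and §2.A (2.14)] -/
theorem binQFClassNumber_neg77683 : BinQF.classNumber (-77683) = 22 := by
  decide +kernel

/-- **`L(1, χ_{−77683}) = 22π/√77683`** (`= 0.24797…`, the G02 value at the ladder rung `D₄₁⁻ = D₄₃⁻`; fundamental by
`isFundamentalDiscriminant_rungs_two`). [cite: DavenportMNT1980, Ch. 6] -/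
theorem LOne_neg77683 : LOne (-77683) = 22 * Real.pi / Real.sqrt 77683 := by
  rw [LOne_eq_of_classNumber_eq isFundamentalDiscriminant_rungs_two.2.2.2.2 (by norm_num)
    binQFClassNumber_neg77683]
  push_cast
  rw [abs_neg, Nat.abs_ofNat]
  ring

/-! ## Rev 2 (append): `w_K = 4, 6` at `d_K = −4, −3`, and the closed forms `L(1, χ_{−4}) = π/4`,
`L(1, χ_{−3}) = π/(3√3)` — the G02 column at ALL fourteen negative bed-1 moduli of `L1a ∪ L1b` -/

section SmallDiscriminants

variable {K : Type*} [Field K] [NumberField K]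

/-- **`w_K = #𝓞_Kˣ` for an imaginary quadratic field**: the unit group is finite (`#𝓞_Kˣ ∈ {2, 4, 6}`, tree
`RingClass.card_units_eq` on an integral basis `(1, ω)`), so every unit is a root of unity and the torsion subgroup
is everything. [cite: Cox2013, §7.A (units of imaginary quadratic orders) and §7.D Thm. 7.24] -/
theorem torsionOrder_eq_card_units_of_discr_neg (h2 : Module.finrank ℚ K = 2) (hd : NumberField.discr K < 0) :
    torsionOrder K = Nat.card (𝓞 K)ˣ := by
  obtain ⟨b, hb⟩ := exists_basis_zero_eq_one h2
  have hω := basis_one_mul_self_eq b hb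
  have hD := discr_eq_sq_add_four_mul b hb
  have hneg : (b.repr (b 1 * b 1) 1) ^ 2 + 4 * b.repr (b 1 * b 1) 0 < 0 := by rw [← hD]; exact hd
  have hcard := RingClass.card_units_eq b hb hω hneg
  have hpos : Nat.card (𝓞 K)ˣ ≠ 0 := by rw [hcard]; split_ifs <;> norm_num
  haveI : Finite (𝓞 K)ˣ := Nat.finite_of_card_ne_zero hpos
  have htop : torsion K = ⊤ := by
    refine eq_top_iff.mpr fun u _ => ?_
    change u ∈ CommGroup.torsion (𝓞 K)ˣ
    rw [CommGroup.mem_torsion]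
    exact isOfFinOrder_of_finite u
  rw [torsionOrder, htop, Subgroup.card_top]

/-- **`w_K = 4` for `d_K = −4`** (`K = ℚ(i)`: units `±1, ±i`). [cite: Cox2013, §7.A (units of imaginary quadratic orders) and §7.D Thm. 7.24] -/
theorem torsionOrder_eq_four_of_discr_eq_neg_four (h2 : Module.finrank ℚ K = 2) (hd : NumberField.discr K = -4) :
    torsionOrder K = 4 := by
  obtain ⟨b, hb⟩ := exists_basis_zero_eq_one h2
  have hω := basis_one_mul_self_eq b hb
  have hD := discr_eq_sq_add_four_mul b hb
  have hneg : (b.repr (b 1 * b 1) 1) ^ 2 + 4 * b.repr (b 1 * b 1) 0 < 0 := by rw [← hD, hd]; norm_num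
  rw [torsionOrder_eq_card_units_of_discr_neg h2 (by rw [hd]; norm_num), RingClass.card_units_eq b hb hω hneg,
    if_neg (by rw [← hD, hd]; norm_num), if_pos (by rw [← hD, hd])]

/-- **`w_K = 6` for `d_K = −3`** (`K = ℚ(√−3)`: the sixth roots of unity). [cite: Cox2013, §7.A (units of imaginary quadratic orders) and §7.D Thm. 7.24] -/
theorem torsionOrder_eq_six_of_discr_eq_neg_three (h2 : Module.finrank ℚ K = 2) (hd : NumberField.discr K = -3) :
    torsionOrder K = 6 := by
  obtain ⟨b, hb⟩ := exists_basis_zero_eq_one h2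
  have hω := basis_one_mul_self_eq b hb
  have hD := discr_eq_sq_add_four_mul b hb
  have hneg : (b.repr (b 1 * b 1) 1) ^ 2 + 4 * b.repr (b 1 * b 1) 0 < 0 := by rw [← hD, hd]; norm_num
  rw [torsionOrder_eq_card_units_of_discr_neg h2 (by rw [hd]; norm_num), RingClass.card_units_eq b hb hω hneg,
    if_pos (by rw [← hD, hd])]

end SmallDiscriminants

/-- **`L(1, χ_{−4}) = π/4`** (Leibniz–Gregory; `h(−4) = 1`, `w = 4`): the G02 value at the bed modulus `D = −4`
(`χ_{−4} = χ₄`). [cite: DavenportMNT1980, Ch. 6] -/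
theorem LOne_neg4 : LOne (-4) = Real.pi / 4 := by
  obtain ⟨K, _, _, h2, hdK⟩ :=
    exists_numberField_discr_eq (isFundamentalDiscriminant_of_mem_bed1Moduli (-4) (by decide))
  rw [LOne_eq_binQFClassNumber_of_discr_neg h2 hdK (by norm_num),
    torsionOrder_eq_four_of_discr_eq_neg_four h2 hdK,
    BinQF.classNumber_eq_one_of_mem_classNumberOneDiscrs (by decide)]
  have h4 : Real.sqrt |((-4 : ℤ) : ℝ)| = 2 := by
    rw [show |((-4 : ℤ) : ℝ)| = 2 ^ 2 by norm_num, Real.sqrt_sq (by norm_num)]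
  rw [h4]
  push_cast
  ring

/-- **`L(1, χ_{−3}) = π/(3√3)`** (`h(−3) = 1`, `w = 6`): the G02 value at the bed modulus `D = −3`.
[cite: DavenportMNT1980, Ch. 6] -/
theorem LOne_neg3 : LOne (-3) = Real.pi / (3 * Real.sqrt 3) := by
  obtain ⟨K, _, _, h2, hdK⟩ :=
    exists_numberField_discr_eq (isFundamentalDiscriminant_of_mem_bed1Moduli (-3) (by decide))
  rw [LOne_eq_binQFClassNumber_of_discr_neg h2 hdK (by norm_num),
    torsionOrder_eq_six_of_discr_eq_neg_three h2 hdK,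
    BinQF.classNumber_eq_one_of_mem_classNumberOneDiscrs (by decide)]
  push_cast
  rw [abs_neg, Nat.abs_ofNat]
  have h3 : Real.sqrt 3 ≠ 0 := by positivity
  field_simp
  ring

/-! ## Rev 3 (append): the negative L2 champions `D = −427` (min `L(1)·log log|D|`) and `D = −222643` (min `L(1)`)
of the bed-1 list of record (200 < |D| ≤ 3·10⁵; engines A ≡ B) — kernel `h(D)` and the closed forms of G02(i) -/

section Champions

/-- A finite square-freeness check (as in `RepairBedModuli`): if `|z| < (B+1)²` and no `2 ≤ x ≤ B` has `x² ∣ |z|`, then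
`z` is square-free. [cite: MontgomeryVaughan2007, §9.3] -/
private theorem squarefree_int_of_check (z : ℤ) (B : ℕ) (h0 : z.natAbs ≠ 0) (hB : z.natAbs < (B + 1) * (B + 1))
    (h : ∀ x ≤ B, 2 ≤ x → ¬ x * x ∣ z.natAbs) : Squarefree z := by
  rw [← Int.squarefree_natAbs, Nat.squarefree_iff_prime_squarefree]
  intro x hx hdvd
  have hle : x * x ≤ z.natAbs := Nat.le_of_dvd (Nat.pos_of_ne_zero h0) hdvd
  have hxB : x ≤ B := by
    by_contra hxB
    have hBx : B + 1 ≤ x := by omega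
    have : (B + 1) * (B + 1) ≤ x * x := Nat.mul_self_le_mul_self hBx
    omega
  exact h x hxB hx.two_le hdvd

/-- `−427 = −7·61` is a fundamental discriminant. [cite: MontgomeryVaughan2007, §9.3] -/
theorem isFundamentalDiscriminant_neg427 : IsFundamentalDiscriminant (-427) :=
  Or.inl ⟨by decide, squarefree_int_of_check _ 20 (by decide) (by decide) (by decide), by decide⟩

/-- `−222643` (`222643` prime) is a fundamental discriminant. [cite: MontgomeryVaughan2007, §9.3] -/
theorem isFundamentalDiscriminant_neg222643 : IsFundamentalDiscriminant (-222643) :=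
  Or.inl ⟨by decide, squarefree_int_of_check _ 471 (by decide) (by decide) (by decide +kernel), by decide⟩

/-- **`h(−427) = 2`** (the bed's L2 champion for `L(1, χ_D)·log log|D|`, negative side). [cite: Cox2013, Thm. 2.13 and §2.A (2.14)] -/
theorem binQFClassNumber_neg427 : BinQF.classNumber (-427) = 2 := by
  decide +kernel

/-- **`L(1, χ_{−427}) = 2π/√427`** (`= 0.30407…`). [cite: DavenportMNT1980, Ch. 6] -/
theorem LOne_neg427 : LOne (-427) = 2 * Real.pi / Real.sqrt 427 := by
  rw [LOne_eq_of_classNumber_eq isFundamentalDiscriminant_neg427 (by norm_num) binQFClassNumber_neg427]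
  push_cast
  rw [abs_neg, Nat.abs_ofNat]
  ring

/-- **`h(−222643) = 33`** (the bed's L2 champion for `L(1, χ_D)`, negative side, `200 < |D| ≤ 3·10⁵`; kernel-decided over
`≈ 1.4·10⁵` candidate forms). [cite: Cox2013, Thm. 2.13 and §2.A (2.14)] -/
theorem binQFClassNumber_neg222643 : BinQF.classNumber (-222643) = 33 := by
  decide +kernel

/-- **`L(1, χ_{−222643}) = 33π/√222643`** (`= 0.21971…`, the smallest genuine `L(1, χ_D)` on the bed, `|D| ≤ 3·10⁵`).
[cite: DavenportMNT1980, Ch. 6] -/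
theorem LOne_neg222643 : LOne (-222643) = 33 * Real.pi / Real.sqrt 222643 := by
  rw [LOne_eq_of_classNumber_eq isFundamentalDiscriminant_neg222643 (by norm_num) binQFClassNumber_neg222643]
  push_cast
  rw [abs_neg, Nat.abs_ofNat]
  ring

end Champions

end Literature.NumberTheory.LFunctions.Zhang2022.Repair.Bed

end
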